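import Literature.Topology.FourManifolds.CobordismAttachmentSimplyConnected
import Literature.AlgebraicTopology.SingularHomology.MayerVietorisExactness
import Literature.AlgebraicTopology.SingularHomology.ExcisionTheorem
import HarnessLib

/-!
# Mayer–Vietoris for `W ∪_ψ X`: `Hₖ(W) ⊕ Hₖ(X) → Hₖ(W ∪_ψ X)` is onto when `Hₖ₋₁` of the seam vanishes

Topic `Literature/Topology/FourManifolds`; companion of `CobordismAttachmentSimplyConnected.lean`,
in the cone of the named fact
`Literature.Topology.FourManifolds.isHCobordant_of_equivalent_intersectionForm` (**Wall 1964,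
Thm. 2**; C. T. C. Wall, *On simply-connected 4-manifolds*, J. London Math. Soc. 39 (1964)
141–149; `HCobordismDonaldson.lean`). After gluing his h-cobordism `R = C ∪ V ∪ (D⁴ × I)`
(p. 145) Wall computes (p. 146): "Now we calculate what has happened to the second homology group
… If we attach `V`, the kernel of `H₂(∂V) → H₂(V)` is `L = K` … we see that the induced maps
`H₂(M₁) → H₂(R)` and `H₂(M₂) → H₂(R)` are isomorphisms". The tool behind "calculate" is the
Mayer–Vietoris sequence of the two pieces of a gluing, in degree `2`, where the seams (`∂V`,
`M₁ # (−M₂)`) are simply connected so that `H₁(seam) = 0`. This file PROVES that tool for the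
tree's witness structures, in the surjectivity form that Wall's recognition step consumes
(`isHCobordant_of_epi_singularHomologyMap_two`, `HCobordismWallDegreeTwo.lean`):

* `BoundaryCollar.GluingData.epi_biprodDesc_map` — for a gluing `P = W₁ ∪_A W₂` along the bottom
  of a collar (`CollarGluing.lean`) with `Hⱼ(A) = 0`: **`Hⱼ₊₁(W₁) ⊕ Hⱼ₊₁(W₂) → Hⱼ₊₁(P)`,
  `(a, b) ↦ j₁_* a + j₂_* b`, is onto** (Mayer–Vietoris for the open cover `U ≃ W₁`, `V ≃ W₂`,
  `U ∩ V ≃ A` of `CollarGluing.lean`, Hatcher 2002 §2.2 p. 149: the connecting map into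
  `Hⱼ(U ∩ V) ≅ Hⱼ(A) = 0` vanishes, so `ψ` is onto by exactness, `exact₂_holds`; the summands
  of `ψ` are `j₁_*`, `j₂_*` up to the homology isomorphisms of the homotopy equivalences).
* `BoundaryCollar.GluingData.epi_map_j₂_of_epi`, `…epi_map_j₁_of_epi` — **if moreover
  `Hⱼ₊₁(A) → Hⱼ₊₁(W₁)` is onto then `j₂_* : Hⱼ₊₁(W₂) → Hⱼ₊₁(P)` is onto** (and symmetrically):
  `j₁_* i₁_* = j₂_* κ₀_*` on the seam, so the image of `j₁_*` lies in that of `j₂_*`. This is the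
  shape of both of Wall's uses: `R₀ = V ∪ C` with `H₂(∂V) → H₂(V)` onto (a handlebody on `0`- and
  `2`-handles), and `R = R₀ ∪ (neck filling)` with `H₂(M₁ # (−M₂)) → H₂(R₀)` onto.
* `CobordismAttachment.epi_biprodDesc_map`, `CobordismAttachment.epi_map_jX_of_epi`,
  `CobordismAttachment.epi_map_jW_of_epi` — the same for an attachment `V = W ∪_ψ X` of a
  cobordism `X` from `M` to `N` to a compact manifold with boundary `W` along `ψ : ∂W ≅ M`
  (Milnor 1965, Thm. 1.4), with the seam hypotheses stated on `M`: `Hⱼ(M) = 0`, and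
  `Hⱼ₊₁(∂W) → Hⱼ₊₁(W)` resp. `inl_* : Hⱼ₊₁(M) → Hⱼ₊₁(X)` onto.

Everything is proved; no named fact and no definition is introduced.

## References

* C. T. C. Wall, *On simply-connected 4-manifolds*, J. London Math. Soc. 39 (1964) 141–149, §2
  p. 146. [WallJLMS1964]
* A. Hatcher, *Algebraic Topology*, CUP (2002), §2.2, pp. 149–150 (Mayer–Vietoris), Prop. 3.42.
  [HatcherAT2002]
* J. Milnor, *Lectures on the h-cobordism theorem*, Princeton (1965), §1, Thm. 1.4.
  [MilnorHCobordism1965]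
-/

open scoped Manifold ContDiff Topology unitInterval
open Set Function Topology CategoryTheory CategoryTheory.Limits
open Literature.AlgebraicTopology.Homotopy Literature.AlgebraicTopology.SingularHomology

noncomputable section

universe u v

/-! ### Mayer–Vietoris for a gluing along the bottom of a collar -/

namespace Literature.AlgebraicTopology.Homotopy.BoundaryCollar.GluingData

variable {W₁ : Type u} [TopologicalSpace W₁] {W₂ : Type u} [TopologicalSpace W₂]
  {A : Type u} [TopologicalSpace A] {κ : BoundaryCollar W₂ A} {i₁ : A → W₁}
  {P : Type u} [TopologicalSpace P] (d : κ.GluingData i₁ P)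
  (R : Type v) [CommRing R] (M : Type v) [AddCommGroup M] [Module R M]

/-- The first piece as a continuous map `W₁ → P`. [folklore] -/
abbrev j₁C : C(W₁, P) := ⟨d.j₁, d.isClosedEmbedding_j₁.continuous⟩

/-- The second piece as a continuous map `W₂ → P`. [folklore] -/
abbrev j₂C : C(W₂, P) := ⟨d.j₂, d.isClosedEmbedding_j₂.continuous⟩

include d in
/-- The seam map `i₁ : A → W₁` is continuous (`j₁ ∘ i₁ = j₂ ∘ κ(·, 0)` with `j₁` an embedding).
[folklore] -/
theorem continuous_i₁ : Continuous i₁ := by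
  rw [d.isClosedEmbedding_j₁.isEmbedding.continuous_iff]
  have h : d.j₁ ∘ i₁ = fun z => d.j₂ (κ.collar (z, 0)) := funext fun z => d.j₁_seam z
  rw [h]
  exact d.isClosedEmbedding_j₂.continuous.comp (κ.continuous.comp (Continuous.prodMk_left 0))

/-- The seam map as a continuous map `A → W₁`. [folklore] -/
abbrev i₁C : C(A, W₁) := ⟨i₁, d.continuous_i₁⟩

/-- On the seam, `j₁ ∘ i₁ = j₂ ∘ κ(·, 0)` as continuous maps. [folklore] -/
theorem j₁C_comp_i₁C : d.j₁C.comp d.i₁C = d.j₂C.comp (bottom κ) := by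
  ext z
  exact d.j₁_seam z

variable [Nonempty A]

/-- `W₁ ≃ U t ↪ P` is `j₁` on the nose. [folklore] -/
theorem subsetIncl_comp_homotopyEquivU {t : I} (ht : 0 < t) :
    (subsetIncl (d.U t)).comp (d.homotopyEquivU ht).toFun = d.j₁C := by
  ext w
  rfl

/-- `V ≃ W₂ → P` (through `j₂`) is the inclusion of `V` on the nose. [folklore] -/
theorem j₂C_comp_homotopyEquivV {t : I} (ht : 0 < t) :
    d.j₂C.comp (d.homotopyEquivV ht).toFun = subsetIncl d.V := by
  ext p
  change d.j₂ ((d.VHomeomorph.symm p : κ.interior) : W₂) = (p : P)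
  have h := d.VHomeomorph_apply_coe (d.VHomeomorph.symm p)
  rw [Homeomorph.apply_symm_apply] at h
  exact h.symm

/-- **Mayer–Vietoris, surjectivity of `ψ`**: if `Hⱼ(A) = 0` then
`ψ : Hⱼ₊₁(U) ⊕ Hⱼ₊₁(V) → Hⱼ₊₁(P)` is onto for the open cover `U 1`, `V` of `CollarGluing.lean`
(the connecting map lands in `Hⱼ(U ∩ V) ≅ Hⱼ(A) = 0`; exactness at `Hⱼ₊₁(P)`, `exact₂_holds`).
[cite: HatcherAT2002, §2.2 p. 149] -/
theorem epi_ψ_of_isZero {j : ℕ} (hA : IsZero (singularHomology R M A j)) :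
    Epi (mayerVietoris.ψ R M (d.U 1) d.V (j + 1)) := by
  have ht : (0 : I) < 1 := zero_lt_one
  have hexc := relativeSingularHomology.isIso_map_of_interior_union_interior_holds R M P
  have hUV := d.interior_U_union_interior_V ht
  obtain ⟨u, hu, hut⟩ := DoubleData.exists_level_between ht
  -- `Hⱼ(U 1 ∩ V) ≅ Hⱼ(A) = 0`
  have hUVzero : IsZero (singularHomology R M ↥(d.U 1 ∩ d.V) j) :=
    hA.of_iso (singularHomology.isoOfHomotopyEquiv R M
      ((κ.stripHomotopyEquiv hu hut).trans (d.UInterVHomeomorph 1).toHomotopyEquiv) j).symm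
  have hδ : mayerVietoris.δ R M (d.U 1) d.V hexc hUV j = 0 := hUVzero.eq_of_tgt _ _
  exact (mayerVietoris.exact₂_holds R M (d.U 1) d.V hexc hUV j).epi_f hδ

/-- **`Hⱼ₊₁(W₁) ⊕ Hⱼ₊₁(W₂) → Hⱼ₊₁(P)`, `(a, b) ↦ j₁_* a + j₂_* b`, is onto when `Hⱼ(A) = 0`**
(Mayer–Vietoris, Hatcher 2002 §2.2 p. 149, for the gluing `P = W₁ ∪_A W₂` along the bottom of a
collar): `ψ` is onto (`epi_ψ_of_isZero`) and factors through this map by the homology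
isomorphisms of `U 1 ≃ W₁`, `V ≃ W₂`. [cite: HatcherAT2002, §2.2 p. 149 and Prop. 3.42] -/
theorem epi_biprodDesc_map {j : ℕ} (hA : IsZero (singularHomology R M A j)) :
    Epi (biprod.desc (singularHomology.map R M d.j₁C (j + 1))
      (singularHomology.map R M d.j₂C (j + 1))) := by
  have ht : (0 : I) < 1 := zero_lt_one
  haveI := d.epi_ψ_of_isZero R M hA
  -- `ψ = (eU⁻¹ ⊕ eV) ≫ desc (j₁_*, j₂_*)` with `eU : H(W₁) ≅ H(U 1)`, `eV : H(V) ≅ H(W₂)`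
  let eU := singularHomology.isoOfHomotopyEquiv R M (d.homotopyEquivU ht) (j + 1)
  let eV := singularHomology.isoOfHomotopyEquiv R M (d.homotopyEquivV ht) (j + 1)
  have hU : eU.hom ≫ singularHomology.map R M (subsetIncl (d.U 1)) (j + 1) =
      singularHomology.map R M d.j₁C (j + 1) := by
    rw [singularHomology.isoOfHomotopyEquiv_hom, ← singularHomology.map_comp,
      d.subsetIncl_comp_homotopyEquivU ht]
  have hV : eV.hom ≫ singularHomology.map R M d.j₂C (j + 1) =
      singularHomology.map R M (subsetIncl d.V) (j + 1) := by
    rw [singularHomology.isoOfHomotopyEquiv_hom, ← singularHomology.map_comp,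
      d.j₂C_comp_homotopyEquivV ht]
  have hfac : biprod.map eU.inv eV.hom ≫ biprod.desc (singularHomology.map R M d.j₁C (j + 1))
      (singularHomology.map R M d.j₂C (j + 1)) = mayerVietoris.ψ R M (d.U 1) d.V (j + 1) := by
    refine biprod.hom_ext' _ _ ?_ ?_
    · rw [biprod.inl_map_assoc, biprod.inl_desc, mayerVietoris.ψ, biprod.inl_desc, ← hU,
        Iso.inv_hom_id_assoc]
    · rw [biprod.inr_map_assoc, biprod.inr_desc, mayerVietoris.ψ, biprod.inr_desc, hV]
  exact epi_of_epi_fac hfac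

/-- **If `Hⱼ(A) = 0` and `i₁_* : Hⱼ₊₁(A) → Hⱼ₊₁(W₁)` is onto, then `j₂_* : Hⱼ₊₁(W₂) → Hⱼ₊₁(P)`
is onto**: every class of `P` is `j₁_* a + j₂_* b` (`epi_biprodDesc_map`), and
`j₁_* (i₁_* x) = j₂_* (κ₀_* x)` on the seam, so `desc (j₁_*, j₂_*) ∘ (i₁_* ⊕ 𝟙)` — an
epimorphism — factors through `j₂_*`. (Wall 1964, p. 146, for `R₀ = V ∪ C` with
`H₂(∂V) → H₂(V)` onto, and for `R` with `H₂(N) → H₂(R₀)` onto.)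
[cite: WallJLMS1964, §2 p. 146] [cite: HatcherAT2002, §2.2 p. 149] -/
theorem epi_map_j₂_of_epi {j : ℕ} (hA : IsZero (singularHomology R M A j))
    [Epi (singularHomology.map R M d.i₁C (j + 1))] :
    Epi (singularHomology.map R M d.j₂C (j + 1)) := by
  haveI := d.epi_biprodDesc_map R M hA
  -- `(i₁_* ⊕ 𝟙) ≫ desc (j₁_*, j₂_*) = desc (κ₀_*, 𝟙) ≫ j₂_*`
  have hfac : biprod.map (singularHomology.map R M d.i₁C (j + 1)) (𝟙 _) ≫
      biprod.desc (singularHomology.map R M d.j₁C (j + 1)) (singularHomology.map R M d.j₂C (j + 1)) =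
      biprod.desc (singularHomology.map R M (bottom κ) (j + 1)) (𝟙 _) ≫
        singularHomology.map R M d.j₂C (j + 1) := by
    refine biprod.hom_ext' _ _ ?_ ?_
    · rw [biprod.inl_map_assoc, biprod.inl_desc, biprod.inl_desc_assoc,
        ← singularHomology.map_comp, ← singularHomology.map_comp, d.j₁C_comp_i₁C]
    · rw [biprod.inr_map_assoc, biprod.inr_desc, biprod.inr_desc_assoc, Category.id_comp]
  have hepi : Epi (biprod.desc (singularHomology.map R M (bottom κ) (j + 1)) (𝟙 _) ≫
      singularHomology.map R M d.j₂C (j + 1)) := by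
    rw [← hfac]
    exact epi_comp _ _
  exact epi_of_epi (biprod.desc (singularHomology.map R M (bottom κ) (j + 1)) (𝟙 _)) _

/-- **If `Hⱼ(A) = 0` and `κ₀_* : Hⱼ₊₁(A) → Hⱼ₊₁(W₂)` is onto, then `j₁_* : Hⱼ₊₁(W₁) → Hⱼ₊₁(P)`
is onto** (the symmetric statement: `desc (j₁_*, j₂_*) ∘ (𝟙 ⊕ κ₀_*) = desc (𝟙, i₁_*) ≫ j₁_*`).
[cite: WallJLMS1964, §2 p. 146] [cite: HatcherAT2002, §2.2 p. 149] -/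
theorem epi_map_j₁_of_epi {j : ℕ} (hA : IsZero (singularHomology R M A j))
    [Epi (singularHomology.map R M (bottom κ) (j + 1))] :
    Epi (singularHomology.map R M d.j₁C (j + 1)) := by
  haveI := d.epi_biprodDesc_map R M hA
  have hfac : biprod.map (𝟙 _) (singularHomology.map R M (bottom κ) (j + 1)) ≫
      biprod.desc (singularHomology.map R M d.j₁C (j + 1)) (singularHomology.map R M d.j₂C (j + 1)) =
      biprod.desc (𝟙 _) (singularHomology.map R M d.i₁C (j + 1)) ≫
        singularHomology.map R M d.j₁C (j + 1) := by
    refine biprod.hom_ext' _ _ ?_ ?_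
    · rw [biprod.inl_map_assoc, biprod.inl_desc, biprod.inl_desc_assoc, Category.id_comp]
    · rw [biprod.inr_map_assoc, biprod.inr_desc, biprod.inr_desc_assoc,
        ← singularHomology.map_comp, ← singularHomology.map_comp, d.j₁C_comp_i₁C]
  have hepi : Epi (biprod.desc (𝟙 _) (singularHomology.map R M d.i₁C (j + 1)) ≫
      singularHomology.map R M d.j₁C (j + 1)) := by
    rw [← hfac]
    exact epi_comp _ _
  exact epi_of_epi (biprod.desc (𝟙 _) (singularHomology.map R M d.i₁C (j + 1))) _

end Literature.AlgebraicTopology.Homotopy.BoundaryCollar.GluingData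

/-! ### Mayer–Vietoris for an attachment `W ∪_ψ X` -/

namespace Literature.Topology.FourManifolds

section Attachment

variable {n : ℕ} {W : Type u} [TopologicalSpace W] [ChartedSpace (EuclideanHalfSpace (n + 2)) W]
  {M N : Type u} [TopologicalSpace M] [ChartedSpace (EuclideanSpace ℝ (Fin (n + 1))) M]
  [TopologicalSpace N] [ChartedSpace (EuclideanSpace ℝ (Fin (n + 1))) N]
  {b : BoundaryData (𝓡∂ (n + 2)) W (𝓡 (n + 1))} {X : Cobordism (n + 1) M N}
  {ψ : b.carrier ≃ₘ⟮𝓡 (n + 1), 𝓡 (n + 1)⟯ M} {V : Type u} [TopologicalSpace V]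
  [ChartedSpace (EuclideanHalfSpace (n + 2)) V]
  (R : Type v) [CommRing R] (A : Type v) [AddCommGroup A] [Module R A]

/-- The boundary inclusion `∂W → W` of a boundary datum as a continuous map. [folklore] -/
abbrev BoundaryData.inclC (b : BoundaryData (𝓡∂ (n + 2)) W (𝓡 (n + 1))) : C(b.carrier, W) :=
  ⟨b.incl, b.isSmoothEmbedding.isEmbedding.continuous⟩

/-- The incoming end `inl : M → X` of a cobordism as a continuous map. [folklore] -/
abbrev Cobordism.inlC (X : Cobordism (n + 1) M N) : C(M, X.W) := ⟨X.inl, X.continuous_inl⟩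

namespace CobordismAttachment

/-- The piece `W` of an attachment as a continuous map into `V`. [folklore] -/
abbrev jWC (At : CobordismAttachment b X ψ V) : C(W, V) := ⟨At.jW, At.continuous_jW⟩

/-- The piece `X` of an attachment as a continuous map into `V`. [folklore] -/
abbrev jXC (At : CobordismAttachment b X ψ V) : C(X.W, V) := ⟨At.jX, At.continuous_jX⟩

variable [CompactSpace W] [T2Space V] [IsManifold (𝓡 (n + 1)) ∞ M] [IsManifold (𝓡 (n + 1)) ∞ N]
  [CompactSpace M] [CompactSpace N] [Nonempty M] (At : CobordismAttachment b X ψ V)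

/-- **`Hⱼ₊₁(W) ⊕ Hⱼ₊₁(X) → Hⱼ₊₁(W ∪_ψ X)`, `(a, c) ↦ jW_* a + jX_* c`, is onto when `Hⱼ(M) = 0`**
(Mayer–Vietoris for the attachment of a cobordism `X` from `M` to `N` to `W` along `ψ : ∂W ≅ M`,
Hatcher 2002 §2.2 p. 149; `V = W ∪_ψ X` is a gluing along the bottom of a collar of the incoming
end of `X`, `CobordismAttachment.collarGluingData`, and `Hⱼ(∂W) ≅ Hⱼ(M) = 0`).
[cite: HatcherAT2002, §2.2 p. 149 and Prop. 3.42] [cite: MilnorHCobordism1965, §1, Thm. 1.4] -/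
theorem epi_biprodDesc_map {j : ℕ} (hM : IsZero (singularHomology R A M j)) :
    Epi (biprod.desc (singularHomology.map R A At.jWC (j + 1))
      (singularHomology.map R A At.jXC (j + 1))) := by
  obtain ⟨κ, hκ⟩ := X.exists_boundaryCollar_inl
  haveI : Nonempty b.carrier := ⟨ψ.symm (Classical.arbitrary M)⟩
  have hc : IsZero (singularHomology R A b.carrier j) :=
    hM.of_iso (singularHomology.mapIso R A ψ.toHomeomorph j)
  exact (At.collarGluingData κ hκ).epi_biprodDesc_map R A hc

/-- **If `Hⱼ(M) = 0` and `Hⱼ₊₁(∂W) → Hⱼ₊₁(W)` is onto, then `jX_* : Hⱼ₊₁(X) → Hⱼ₊₁(W ∪_ψ X)` is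
onto** — Wall 1964, p. 146, the shape of "If we attach `V`, the kernel of `H₂(∂V) → H₂(V)` is
`L`" for `R₀ = V ∪ C` (a handlebody `V` on `0`- and `2`-handles has `H₂(∂V) → H₂(V)` onto) and of
the final step for `R` (`H₂(M₁ # (−M₂)) → H₂(R₀)` onto). [cite: WallJLMS1964, §2 p. 146] [cite: HatcherAT2002, §2.2 p. 149] -/
theorem epi_map_jX_of_epi {j : ℕ} (hM : IsZero (singularHomology R A M j))
    [Epi (singularHomology.map R A b.inclC (j + 1))] :
    Epi (singularHomology.map R A At.jXC (j + 1)) := by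
  obtain ⟨κ, hκ⟩ := X.exists_boundaryCollar_inl
  haveI : Nonempty b.carrier := ⟨ψ.symm (Classical.arbitrary M)⟩
  have hc : IsZero (singularHomology R A b.carrier j) :=
    hM.of_iso (singularHomology.mapIso R A ψ.toHomeomorph j)
  haveI : Epi (singularHomology.map R A (At.collarGluingData κ hκ).i₁C (j + 1)) :=
    ‹Epi (singularHomology.map R A b.inclC (j + 1))›
  exact (At.collarGluingData κ hκ).epi_map_j₂_of_epi R A hc

/-- **If `Hⱼ(M) = 0` and `inl_* : Hⱼ₊₁(M) → Hⱼ₊₁(X)` is onto, then `jW_* : Hⱼ₊₁(W) → Hⱼ₊₁(W ∪_ψ X)`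
is onto** (the symmetric statement; e.g. `X` an h-cobordism). [cite: WallJLMS1964, §2 p. 146] [cite: HatcherAT2002, §2.2 p. 149] -/
theorem epi_map_jW_of_epi {j : ℕ} (hM : IsZero (singularHomology R A M j))
    [Epi (singularHomology.map R A X.inlC (j + 1))] :
    Epi (singularHomology.map R A At.jWC (j + 1)) := by
  obtain ⟨κ, hκ⟩ := X.exists_boundaryCollar_inl
  haveI : Nonempty b.carrier := ⟨ψ.symm (Classical.arbitrary M)⟩
  have hc : IsZero (singularHomology R A b.carrier j) :=
    hM.of_iso (singularHomology.mapIso R A ψ.toHomeomorph j)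
  -- the bottom of the reparametrised collar is `inl ∘ ψ`, onto on `Hⱼ₊₁` with `inl_*`
  have hbot : BoundaryCollar.GluingData.bottom (κ.precompHomeomorph ψ.toHomeomorph) =
      X.inlC.comp (ψ.toHomeomorph : C(b.carrier, M)) := by
    ext z
    change κ.collar (ψ.toHomeomorph z, 0) = X.inl (ψ.toHomeomorph z)
    exact hκ _
  haveI : Epi (singularHomology.map R A (BoundaryCollar.GluingData.bottom (κ.precompHomeomorph ψ.toHomeomorph)) (j + 1)) := by
    rw [hbot, singularHomology.map_comp]
    haveI : IsIso (singularHomology.map R A (ψ.toHomeomorph : C(b.carrier, M)) (j + 1)) :=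
      (singularHomology.mapIso R A ψ.toHomeomorph (j + 1)).isIso_hom
    exact epi_comp _ _
  exact (At.collarGluingData κ hκ).epi_map_j₁_of_epi R A hc

end CobordismAttachment

end Attachment

end Literature.Topology.FourManifolds

end
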